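import Mathlib.Analysis.SpecialFunctions.Exp
import Mathlib.MeasureTheory.Integral.Lebesgue.Add
import Literature.MathematicalPhysics.KineticTheory.HardSphereEuler
import Literature.Barriers.AtomisticToContinuum.HighMomentumCutoff
import HarnessLib

/-!
# Crux stmt-AtomisticToContinuum-16625 `TwoClocks.TransferEntropyClock`, line `tail-rate`, stub `stub_tailToMoment`
# (verbatim the registered stub `stub_tailToMoment` of item stmt-AtomisticToContinuum-14415)

Pure measure theory (support file). Sub-Gaussian tails at rate `κ` of the summed one-particle
speed laws of ANY measure `μ` on `(N+1)`-particle configurations pushed through ANY measurable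
configuration map `F`,

  `∑ᵢ μ {z | k ≤ ‖vᵢ(F z)‖} ≤ (N+1) · C · e^{-κ k²}`  for every `k : ℕ`,

give an `N`-uniform bound on the expected empirical exponential velocity moment of every lower
order `0 < c < κ`:

  `∫ (N+1)⁻¹ ∑ᵢ exp(c ‖vᵢ(F z)‖²) dμ(z) ≤ C · K`,  `K = ∑ₖ e^{c(k+1)² - κk²} < ∞`

(`Literature.Barriers.AtomisticToContinuum.expVelocityMoment c`), with `K` depending on `κ, c`
only.

## Proof

Shell decomposition: for `r ≥ 0`, `exp(c r²) ≤ exp(c (⌊r⌋₊+1)²) ≤ ∑ₖ 𝟙[k ≤ r] exp(c (k+1)²)`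
(`ofReal_exp_mul_sq_le_tsum_indicator`); Tonelli (`lintegral_finsetSum`, `lintegral_tsum`,
`lintegral_indicator_const`) turns the integral of the right-hand side into
`(N+1)⁻¹ ∑ₖ e^{c(k+1)²} ∑ᵢ μ{k ≤ ‖vᵢ∘F‖} ≤ C ∑ₖ e^{c(k+1)² - κk²}`; the series converges by
completing the square, `c(k+1)² - κk² + k ≤ c + (2c+1)²/(4(κ-c))` (`summable_exp_shell`).
-/

noncomputable section

open MeasureTheory
open scoped ENNReal
open Literature.MathematicalPhysics.KineticTheory Literature.Analysis.FluidPDE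
open Literature.Barriers.AtomisticToContinuum

namespace Summit.AtomisticToContinuum.HydrodynamicLimit.Theorems.TransferEntropyClockTailToMoment

/-- **The shell series converges.** For `c < κ` the real series `∑ₖ exp(c (k+1)² - κ k²)` is
summable: completing the square gives `c (x+1)² - κ x² + x ≤ c + (2c+1)²/(4(κ-c))` for all real
`x`, so the terms are dominated by `e^B · e^{-k}`. [folklore] -/
theorem summable_exp_shell {κ c : ℝ} (hcκ : c < κ) :
    Summable fun k : ℕ => Real.exp (c * ((k : ℝ) + 1) ^ 2 - κ * (k : ℝ) ^ 2) := by
  have hδ : 0 < κ - c := sub_pos.2 hcκ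
  set B : ℝ := c + (2 * c + 1) ^ 2 / (4 * (κ - c)) with hB_def
  have hB : ∀ x : ℝ, c * (x + 1) ^ 2 - κ * x ^ 2 + x ≤ B := by
    intro x
    have h4 : 0 < 4 * (κ - c) := by positivity
    have hsq : 0 ≤ (2 * (κ - c) * x - (2 * c + 1)) ^ 2 / (4 * (κ - c)) := by positivity
    have hexp : (2 * (κ - c) * x - (2 * c + 1)) ^ 2 / (4 * (κ - c)) =
        (κ - c) * x ^ 2 - (2 * c + 1) * x + (2 * c + 1) ^ 2 / (4 * (κ - c)) := by
      field_simp
      ring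
    rw [hexp] at hsq
    rw [hB_def]
    nlinarith [hsq]
  have h1 : Summable fun k : ℕ =>
      Real.exp ((-1) * (B + κ * (k : ℝ) ^ 2 - c * ((k : ℝ) + 1) ^ 2)) :=
    Real.summable_exp_nat_mul_of_ge (by norm_num) fun k => by linarith [hB k]
  refine (h1.mul_left (Real.exp B)).congr fun k => ?_
  rw [← Real.exp_add]
  congr 1
  ring

/-- **One shell dominates.** For `c ≥ 0` and a non-negative "speed" `ρ x`, the exponential moment
`exp(c ρ(x)²)` is at most the `k = ⌊ρ x⌋₊` term of the shell sum `∑ₖ 𝟙[k ≤ ρ x] exp(c (k+1)²)`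
(as extended non-negative reals), since `⌊ρ x⌋₊ ≤ ρ x < ⌊ρ x⌋₊ + 1`. [folklore] -/
theorem ofReal_exp_mul_sq_le_tsum_indicator {α : Type*} (ρ : α → ℝ) {c : ℝ} (hc : 0 ≤ c)
    (x : α) (hx : 0 ≤ ρ x) :
    ENNReal.ofReal (Real.exp (c * ρ x ^ 2)) ≤
      ∑' k : ℕ, {y | (k : ℝ) ≤ ρ y}.indicator
        (fun _ => ENNReal.ofReal (Real.exp (c * ((k : ℝ) + 1) ^ 2))) x := by
  refine le_trans ?_ (ENNReal.le_tsum ⌊ρ x⌋₊)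
  rw [Set.indicator_of_mem (show x ∈ {y | ((⌊ρ x⌋₊ : ℕ) : ℝ) ≤ ρ y} from Nat.floor_le hx)]
  refine ENNReal.ofReal_le_ofReal (Real.exp_le_exp.2 (mul_le_mul_of_nonneg_left ?_ hc))
  exact pow_le_pow_left₀ hx (Nat.lt_floor_add_one (ρ x)).le 2

/-- **Sub-Gaussian tails ⇒ empirical exponential velocity moment** (S_G3 of line `tail-rate`,
verbatim item 14415's registered `stub_tailToMoment`). For `0 < c < κ` there is `K < ∞`
(namely `∑ₖ e^{c(k+1)²} e^{-κk²}`) such that for every `N`, every measure `μ` on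
`(N+1)`-particle configurations over `𝕋³ × ℝ³`, every measurable configuration map `F` and every
`C : ℝ≥0∞`, the tail bounds `∑ᵢ μ{z | k ≤ ‖vᵢ(F z)‖} ≤ (N+1) C e^{-κk²}` (`k : ℕ`) give
`∫ (N+1)⁻¹ ∑ᵢ exp(c ‖vᵢ(F z)‖²) dμ ≤ C K` (shells `e^{cr²} ≤ ∑ₖ 𝟙[k ≤ r] e^{c(k+1)²}`, Tonelli).
[folklore] -/
theorem stub_tailToMoment :
    ∀ (κ c : ℝ), 0 < c → c < κ → ∃ K : ℝ≥0∞, K < ⊤ ∧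
      ∀ (N : ℕ)
        (μ : Measure (Literature.Analysis.FluidPDE.Config (N + 1) (Fin 3)
          Literature.MathematicalPhysics.KineticTheory.T3))
        (F : Literature.Analysis.FluidPDE.Config (N + 1) (Fin 3) Literature.MathematicalPhysics.KineticTheory.T3 →
          Literature.Analysis.FluidPDE.Config (N + 1) (Fin 3) Literature.MathematicalPhysics.KineticTheory.T3),
        Measurable F → ∀ C : ℝ≥0∞,
          (∀ k : ℕ, (∑ i : Fin (N + 1), μ {z | (k : ℝ) ≤ ‖(F z i).2‖}) ≤
              ((N : ℝ≥0∞) + 1) * C * ENNReal.ofReal (Real.exp (-(κ * (k : ℝ) ^ 2)))) →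
          (∫⁻ z, Literature.Barriers.AtomisticToContinuum.expVelocityMoment c (F z) ∂μ) ≤ C * K := by
  intro κ c hc hcκ
  -- the shell weights `a k = e^{c(k+1)²}` and the tail profile `b k = e^{-κk²}`
  set a : ℕ → ℝ≥0∞ := fun k => ENNReal.ofReal (Real.exp (c * ((k : ℝ) + 1) ^ 2)) with ha_def
  set b : ℕ → ℝ≥0∞ := fun k => ENNReal.ofReal (Real.exp (-(κ * (k : ℝ) ^ 2))) with hb_def
  refine ⟨∑' k : ℕ, a k * b k, ?_, ?_⟩
  · -- `K < ∞`: the real shell series is summable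
    refine lt_of_le_of_lt (le_of_eq (tsum_congr fun k => ?_)) (summable_exp_shell hcκ).tsum_ofReal_lt_top
    rw [ha_def, hb_def]
    simp only []
    rw [← ENNReal.ofReal_mul (Real.exp_pos _).le, ← Real.exp_add, ← sub_eq_add_neg]
  · intro N μ F hF C hC
    have hn0 : ((N + 1 : ℕ) : ℝ≥0∞) ≠ 0 := by exact_mod_cast Nat.succ_ne_zero N
    have hnt : ((N + 1 : ℕ) : ℝ≥0∞) ≠ ∞ := ENNReal.natCast_ne_top _
    -- measurability of the speed of particle `i` after `F`, and of the tail events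
    have hρ : ∀ i : Fin (N + 1),
        Measurable fun z : Config (N + 1) (Fin 3) T3 => ‖(F z i).2‖ := fun i =>
      ((measurable_pi_apply i).comp hF).snd.norm
    have hS : ∀ (i : Fin (N + 1)) (k : ℕ),
        MeasurableSet {z : Config (N + 1) (Fin 3) T3 | (k : ℝ) ≤ ‖(F z i).2‖} := fun i k =>
      measurableSet_le measurable_const (hρ i)
    have hmik : ∀ (i : Fin (N + 1)) (k : ℕ), Measurable fun z : Config (N + 1) (Fin 3) T3 =>
        {y : Config (N + 1) (Fin 3) T3 | (k : ℝ) ≤ ‖(F y i).2‖}.indicator (fun _ => a k) z :=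
      fun i k => measurable_const.indicator (hS i k)
    have hmi : ∀ i : Fin (N + 1), Measurable fun z : Config (N + 1) (Fin 3) T3 =>
        ∑' k : ℕ, {y : Config (N + 1) (Fin 3) T3 | (k : ℝ) ≤ ‖(F y i).2‖}.indicator
          (fun _ => a k) z :=
      fun i => Measurable.tsum (hmik i)
    -- pointwise shell bound on the empirical moment
    have hpt : ∀ z : Config (N + 1) (Fin 3) T3,
        expVelocityMoment c (F z) ≤ ((N + 1 : ℕ) : ℝ≥0∞)⁻¹ *
          ∑ i, ∑' k : ℕ, {y : Config (N + 1) (Fin 3) T3 | (k : ℝ) ≤ ‖(F y i).2‖}.indicator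
            (fun _ => a k) z := by
      intro z
      rw [expVelocityMoment_eq, ENNReal.ofReal_mul (inv_nonneg.2 (Nat.cast_nonneg _)),
        ENNReal.ofReal_inv_of_pos (by exact_mod_cast Nat.succ_pos N), ENNReal.ofReal_natCast,
        ENNReal.ofReal_sum_of_nonneg fun i _ => (Real.exp_pos _).le]
      gcongr with i
      exact ofReal_exp_mul_sq_le_tsum_indicator (fun y => ‖(F y i).2‖) hc.le z (norm_nonneg _)
    calc ∫⁻ z, expVelocityMoment c (F z) ∂μ
        ≤ ∫⁻ z, ((N + 1 : ℕ) : ℝ≥0∞)⁻¹ *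
            ∑ i, ∑' k : ℕ, {y : Config (N + 1) (Fin 3) T3 | (k : ℝ) ≤ ‖(F y i).2‖}.indicator
              (fun _ => a k) z ∂μ := lintegral_mono hpt
      _ = ((N + 1 : ℕ) : ℝ≥0∞)⁻¹ *
            ∑ i, ∑' k : ℕ, a k * μ {y | (k : ℝ) ≤ ‖(F y i).2‖} := by
          rw [lintegral_const_mul _ (Finset.measurable_sum _ fun i _ => hmi i),
            lintegral_finsetSum _ fun i _ => hmi i]
          congr 1
          refine Finset.sum_congr rfl fun i _ => ?_
          rw [lintegral_tsum fun k => (hmik i k).aemeasurable]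
          exact tsum_congr fun k => lintegral_indicator_const (hS i k) _
      _ = ((N + 1 : ℕ) : ℝ≥0∞)⁻¹ *
            ∑' k : ℕ, a k * ∑ i, μ {y | (k : ℝ) ≤ ‖(F y i).2‖} := by
          rw [← Summable.tsum_finsetSum (fun _ _ => ENNReal.summable)]
          simp_rw [Finset.mul_sum]
      _ ≤ ((N + 1 : ℕ) : ℝ≥0∞)⁻¹ * ∑' k : ℕ, a k * (((N : ℝ≥0∞) + 1) * C * b k) := by
          gcongr with k
          exact hC k
      _ = C * ∑' k : ℕ, a k * b k := by
          have h2 : ∀ k : ℕ, a k * (((N : ℝ≥0∞) + 1) * C * b k) =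
              ((N : ℝ≥0∞) + 1) * C * (a k * b k) := fun k => by ring
          simp_rw [h2]
          rw [ENNReal.tsum_mul_left, ← mul_assoc, ← mul_assoc, ← Nat.cast_succ,
            ENNReal.inv_mul_cancel hn0 hnt, one_mul]

end Summit.AtomisticToContinuum.HydrodynamicLimit.Theorems.TransferEntropyClockTailToMoment

end
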